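import Summits.HodgeConjecture.HodgeConjecture.Theorems.MarkmanPartnerTransportPicardThreeK3SquaresSectorTransport
import Summits.HodgeConjecture.HodgeConjecture.Theorems.BoundaryReadoutPullbackAlgebraic
import Literature.AlgebraicGeometry.HodgeTheory.CorrespondenceTranspose
import Literature.AlgebraicGeometry.HodgeTheory.KugaSatakeClassBetti
import Literature.AlgebraicGeometry.Surfaces.GeometricGenusOneAssociatedK3Surface
import Summits.HodgeConjecture.HodgeConjecture.Theorems.NoetherLefschetzOneUpK3TypeNetsOddPrimeTranscendental

/-!
# Route MarkmanPartnerTransport · crux `PicardThreeK3Squares` (stmt-HodgeConjecture-19652) —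
# the TRANSPOSE of an algebraic correspondence between two surfaces: algebraic, adjoint, rational,
# `T ↦ T`, and `φ ∘ ᵗφ = c·id` on `T` for a similitude

Engine for the `√6`-sector (`…SqrtSix`): for smooth projective complex surfaces `X`, `Y` and a class
`γ ∈ H⁴((X ⊗ Y)(ℂ); ℂ)` acting as `φ = [γ]_* = fst_*(snd^*(·) ∪ γ) : H²(Y) → H²(X)` (the tree's
`complexGysin` for the complex orientation family; `corrAction`), the TRANSPOSE class
`ᵗγ = swap^* γ ∈ H⁴((Y ⊗ X)(ℂ); ℂ)` acts as `ᵗφ : H²(X) → H²(Y)` with: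

* `transpose_mem_algebraicClasses` — `ᵗγ` is algebraic if `γ` is (pull-back along the swap,
  `fulton1998_map_mem_algebraicClasses_holds`);
* `traceC_transpose_cup` — the ADJUNCTION `∫_Y ᵗφ(w) ∪ x = ∫_X φ(x) ∪ w` (the tree's
  `traceC_corrAction_map_swap_cup`, sign `(−1)^{2·2} = 1`);
* `exists_algebraic_add_transcendental` — `H²(X) = N¹H²(X) + T(X)` (Gram-dual basis of `N¹`, Hodge index);
* `isRationalClass_transpose` — if `φ` is rational then so is `ᵗφ` (the adjoint of a rational map for
  the RATIONAL perfect pairings `∫ a ∪ b`: Poincaré duality over `ℚ`, `cupPairingBetti_nondegenerate`);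
* `transpose_mem_transcendentalSubspace` — if `φ` is rational and `(1,1)`-type-preserving (so
  `φ(N¹(Y)) ⊆ N¹(X)`) then `ᵗφ(T(X)) ⊆ T(Y)`;
* `transpose_comp_eq_smul`, `comp_transpose_eq_smul` — if moreover `φ` maps `T(Y)` onto `T(X)` with
  MULTIPLIER `m` in markings `(η_X, p_X)`, `(η_Y, p_Y)` (`(η_X φa · η_X φb) = m (η_Y a · η_Y b)` on
  `T(Y)`), then `ᵗφ ∘ φ = c • id` on `T(Y)` and `φ ∘ ᵗφ = c • id` on `T(X)` with
  `c = m · ∫_X p_X / ∫_Y p_Y ≠ 0` (for `m ≠ 0`).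

No definition, no named fact, no sorry. Prover seat hodge-nonav-19652-p1 (gen 4),
`--supports stmt-HodgeConjecture-19652`.

References: B. Kahn, *Zeta and L-functions of varieties and motives* (2020) §3.5.3 Lemma 3.48; W. Fulton,
*Intersection Theory* §16.1, *Young Tableaux* App. B; C. Voisin, *Hodge Theory II* (10.7), Prop. 9.20;
M. Varesco, Math. Z. 305 (2023) §2.
-/

set_option linter.dupNamespace false

noncomputable section

namespace Summit.HodgeConjecture.HodgeConjecture.Theorems.MarkmanPartnerTransport.SimilitudeTranspose

open scoped Manifold
open CategoryTheory MonoidalCategory CartesianMonoidalCategory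
open Literature.AlgebraicGeometry Literature.AlgebraicGeometry.Motives Literature.AlgebraicGeometry.HodgeTheory
open Literature.AlgebraicGeometry.Surfaces
open Literature.AlgebraicTopology.SingularHomology
open Summit.HodgeConjecture.HodgeConjecture.Theorems
open Summit.HodgeConjecture.HodgeConjecture.Theorems.NikulinTwinTransport
open Summit.HodgeConjecture.HodgeConjecture.Theorems.NikulinTwinTransport.SquareGlueFree

variable {X Y : SchemeOver ℂ}

/-- `Corr[μ, X, Y, hX, hY ; γ, y] = [γ]_* y = fst_* (snd^* y ∪ γ) ∈ H²(X(ℂ); ℂ)` for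
`γ ∈ H⁴((X ⊗ Y)(ℂ); ℂ)`, `y ∈ H²(Y(ℂ); ℂ)`, `hX hY : IsSmoothProjective 2 _` — the expression of
`Buskin2019_hodgeIsometry_algebraic` / `corrComp_K3_of_cup` (there at `IsK3Surface.isSmoothProjective`).
Local notation only. -/
local notation3 (prettyPrint := false) "Corr[" μ ", " X ", " Y ", " hX ", " hY " ; " γ ", " y "]" =>
  complexGysin μ (IsSmoothProjective.tensor_holds hX hY) hX (SemiCartesianMonoidalCategory.fst X Y)
    (rfl : 2 * 1 + 2 * 2 + 2 * 2 = 2 * 1 + 2 * (2 + 2))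
    (cupProduct (rfl : 2 * 1 + 2 * 2 = 2 * 1 + 2 * 2)
      (complexBetti.map (SemiCartesianMonoidalCategory.snd X Y) (2 * 1) y) γ)

/-- `Transp[X, Y ; γ] = swap^* γ ∈ H⁴((Y ⊗ X)(ℂ); ℂ)`, the transpose of `γ ∈ H⁴((X ⊗ Y)(ℂ); ℂ)`
(`swap = (snd, fst) : Y ⊗ X ⟶ X ⊗ Y`). Local notation only. -/
local notation3 (prettyPrint := false) "Transp[" X ", " Y " ; " γ "]" =>
  complexBetti.map (CartesianMonoidalCategory.lift (SemiCartesianMonoidalCategory.snd Y X)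
    (SemiCartesianMonoidalCategory.fst Y X)) (2 * 2) γ

/-! ### The transpose class is algebraic -/

/-- **`ᵗγ = swap^* γ` is algebraic when `γ` is** (pull-back of algebraic classes along a morphism of
smooth projective varieties, the tree's theorem `fulton1998_map_mem_algebraicClasses_holds`).
[cite: Fulton1998, §19.2 Cor. 19.2 (b)] -/
theorem transpose_mem_algebraicClasses (hX : IsSmoothProjective 2 X) (hY : IsSmoothProjective 2 Y)
    {γ : complexBetti (X ⊗ Y) (2 * 2)} (hγ : γ ∈ algebraicClasses (X ⊗ Y) 2) :
    Transp[X, Y ; γ] ∈ algebraicClasses (Y ⊗ X) 2 :=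
  fulton1998_map_mem_algebraicClasses_holds _ (IsSmoothProjective.tensor_holds hX hY)
    (IsSmoothProjective.tensor_holds hY hX) 2 γ hγ

/-! ### The adjunction formula in the `Corr` spelling -/

/-- **`∫_Y ᵗφ(w) ∪ x = ∫_X φ(x) ∪ w`** for `φ = [γ]_*`, `ᵗφ = [ᵗγ]_*` (complex orientations), `w ∈ H²(X)`,
`x ∈ H²(Y)`: the tree's `traceC_corrAction_map_swap_cup` (Kahn Lemma 3.48: `ᵗφ` is the adjoint of `φ`
for the Poincaré pairings; the Koszul sign `(−1)^{2·2}` is `1`). [cite: Kahn2020, §3.5.3 Lemma 3.48]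
[cite: FultonYoungTableaux1997, Appendix B §B.1 (5)–(6)] -/
theorem traceC_transpose_cup (hX : IsSmoothProjective 2 X) (hY : IsSmoothProjective 2 Y)
    (γ : complexBetti (X ⊗ Y) (2 * 2)) (w : complexBetti X (2 * 1)) (x : complexBetti Y (2 * 1)) :
    traceC hY (cupProduct (rfl : 2 * 1 + 2 * 1 = 2 * 2)
        (Corr[complexOrientationFamily, Y, X, hY, hX ; Transp[X, Y ; γ], w]) x) =
      traceC hX (cupProduct (rfl : 2 * 1 + 2 * 1 = 2 * 2)
        (Corr[complexOrientationFamily, X, Y, hX, hY ; γ, x]) w) := by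
  have h := traceC_corrAction_map_swap_cup hX hY (e := 2) (a := 2 * 1) (a' := 2 * 1) (b := 2 * 1)
    (b' := 2 * 1) rfl rfl rfl rfl γ w x
  rw [corrAction_apply, corrAction_apply, show ((-1 : ℂ) ^ (2 * 1 * (2 * 1))) = 1 by norm_num, one_mul] at h
  exact h

/-! ### `H²(X) = N¹H²(X) + T(X)` -/

/-- **Every class of `H²(X(ℂ); ℂ)` is an algebraic class plus a transcendental one**, for a smooth
projective surface `X`: with a rational basis `dᵢ` of `N¹` and the inverse `M` of its Gram matrix (Hodge
index: the cup form on `N¹` is non-degenerate, `exists_neronSeveri_gramBasis`),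
`P y = Σᵢ (Σⱼ Mᵢⱼ ∫ y ∪ dⱼ) dᵢ` lies in `N¹` and `y − P y` is cup-orthogonal to `N¹`.
[cite: VoisinHodgeI2002, Thm. 6.32 and Lemma 11.41] -/
theorem exists_algebraic_add_transcendental (hX : IsSmoothProjective 2 X) (y : complexBetti X (2 * 1)) :
    ∃ n ∈ algebraicClasses X 1, y - n ∈ transcendentalSubspace X := by
  classical
  have h4 : 2 * 1 + 2 * 1 = 2 * 2 := rfl
  obtain ⟨r, d, M, -, hdN, -, hspanN, hmulinv, -⟩ := exists_neronSeveri_gramBasis hX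
  have hsymm : ∀ a b : complexBetti X (2 * 1), cupProduct h4 a b = cupProduct h4 b a := fun a b ↦ by
    rw [cupProduct_gradedComm_holds ℂ _ h4 h4]
    norm_num
  set a : Fin r → ℂ := fun j ↦ traceC hX (cupProduct h4 y (d j)) with hadef
  set P : complexBetti X (2 * 1) := ∑ i, (∑ j, ((M i j : ℚ) : ℂ) * a j) • d i with hPdef
  refine ⟨P, Submodule.sum_mem _ fun i _ ↦ Submodule.smul_mem _ _ (hdN i), ?_⟩
  rw [mem_transcendentalSubspace_iff_forall_algebraicClasses hX]
  intro c hc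
  have hc' : c ∈ Submodule.span ℂ (Set.range d) := by rw [hspanN]; exact hc
  clear hc
  induction hc' using Submodule.span_induction with
  | mem c hc =>
    obtain ⟨k, rfl⟩ := hc
    apply eq_zero_of_traceC_eq_zero hX
    have hP : traceC hX (cupProduct h4 P (d k)) = a k := by
      rw [hPdef, map_sum, LinearMap.sum_apply, map_sum]
      simp only [map_smul, LinearMap.smul_apply, smul_eq_mul]
      have hg : ∀ i, traceC hX (cupProduct h4 (d i) (d k)) = traceC hX (cupProduct h4 (d k) (d i)) :=
        fun i ↦ by rw [hsymm]
      simp_rw [hg]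
      calc ∑ i, (∑ j, ((M i j : ℚ) : ℂ) * a j) * traceC hX (cupProduct h4 (d k) (d i))
          = ∑ i, ∑ j, ((M i j : ℚ) : ℂ) * a j * traceC hX (cupProduct h4 (d k) (d i)) := by
            simp_rw [Finset.sum_mul]
        _ = ∑ j, ∑ i, ((M i j : ℚ) : ℂ) * a j * traceC hX (cupProduct h4 (d k) (d i)) := Finset.sum_comm
        _ = ∑ j, a j * ∑ i, traceC hX (cupProduct h4 (d k) (d i)) * ((M i j : ℚ) : ℂ) := by
            refine Finset.sum_congr rfl fun j _ ↦ ?_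
            rw [Finset.mul_sum]
            exact Finset.sum_congr rfl fun i _ ↦ by ring
        _ = ∑ j, a j * (if k = j then 1 else 0) := by
            refine Finset.sum_congr rfl fun j _ ↦ ?_
            rw [hmulinv k j]
        _ = a k := by simp [Finset.sum_ite_eq, Finset.mem_univ]
    rw [map_sub, LinearMap.sub_apply, map_sub, hP, hadef, sub_self]
  | zero => rw [map_zero]
  | add c c' _ _ hc hc' => rw [map_add, hc, hc', add_zero]
  | smul t c _ hc => rw [map_smul, hc, smul_zero]

/-! ### Rational maps descend to `H²(·; ℚ)` -/

/-- **A `ℂ`-linear map `H²(Y(ℂ); ℂ) → H²(X(ℂ); ℂ)` preserving rational classes is the complexification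
of a `ℚ`-linear map `H²(Y(ℂ); ℚ) → H²(X(ℂ); ℚ)`** (pointwise preimages along the injective `ofRatClass`;
cross-surface form of `OddPrimeSquares.exists_ratEnd_of_isRationalClass`). [cite: HatcherAT2002, §3.1 p. 198] -/
theorem exists_ratHom_of_isRationalClass (f : complexBetti Y (2 * 1) →ₗ[ℂ] complexBetti X (2 * 1))
    (hf : ∀ y, IsRationalClass y → IsRationalClass (f y)) :
    ∃ g : bettiCohomology Y (2 * 1) →ₗ[ℚ] bettiCohomology X (2 * 1),
      ∀ v, ofRatClass (Motives.ComplexPoints X) (2 * 1) (g v) =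
        f (ofRatClass (Motives.ComplexPoints Y) (2 * 1) v) := by
  have hE : ∀ a : bettiCohomology Y (2 * 1), ∃ b : bettiCohomology X (2 * 1),
      ofRatClass (Motives.ComplexPoints X) (2 * 1) b = f (ofRatClass (Motives.ComplexPoints Y) (2 * 1) a) :=
    fun a ↦ by
      obtain ⟨b, hb⟩ := (isRationalClass_iff_mem_range_ofRatClass _).1 (hf _ (isRationalClass_ofRatClass a))
      exact ⟨b, hb⟩
  choose t ht using hE
  have hinj := ofRatClass_injective (Y := Motives.ComplexPoints X) (2 * 1)
  let g : bettiCohomology Y (2 * 1) →ₗ[ℚ] bettiCohomology X (2 * 1) :=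
    { toFun := t
      map_add' := fun a b ↦ hinj (by rw [ht, map_add, map_add, map_add, ht, ht])
      map_smul' := fun q a ↦ hinj (by
        rw [ht, Motives.ofRatClass_smul, map_smul, RingHom.id_apply, Motives.ofRatClass_smul, ht]) }
  exact ⟨g, fun v ↦ ht v⟩

/-! ### The transpose of a rational correspondence is rational -/

/-- **If `φ = [γ]_*` preserves rational classes, so does `ᵗφ = [ᵗγ]_*`.** `ᵗφ` is the adjoint of `φ` for
the pairings `∫ a ∪ b` (adjunction formula), which are RATIONAL and PERFECT on `H²(·; ℚ)` (Poincaré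
duality over `ℚ`, `cupPairingBetti_nondegenerate`): for `w` rational the functional
`a ↦ ∫_X φ(a) ∪ w` on `H²(Y; ℚ)` is represented by a rational class `b₀`, and `ᵗφ(w) − b₀` pairs to zero
with all rational classes, which span `H²(Y(ℂ); ℂ)`. [cite: Kahn2020, §3.5.3 Lemma 3.48]
[cite: HatcherAT2002, §3.3 Prop. 3.38] -/
theorem isRationalClass_transpose (hX : IsSmoothProjective 2 X) (hY : IsSmoothProjective 2 Y)
    (γ : complexBetti (X ⊗ Y) (2 * 2))
    (hrat : ∀ y, IsRationalClass y → IsRationalClass (Corr[complexOrientationFamily, X, Y, hX, hY ; γ, y]))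
    {w : complexBetti X (2 * 1)} (hw : IsRationalClass w) :
    IsRationalClass (Corr[complexOrientationFamily, Y, X, hY, hX ; Transp[X, Y ; γ], w]) := by
  classical
  have h4 : 2 * 1 + 2 * 1 = 2 * 2 := rfl
  haveI : Module.Finite ℚ (bettiCohomology Y (2 * 1)) := BettiUniverse.finite hY (2 * 1)
  -- `φ` as a linear map and its rational descent `g`
  set φ : complexBetti Y (2 * 1) →ₗ[ℂ] complexBetti X (2 * 1) :=
    (complexGysin complexOrientationFamily (IsSmoothProjective.tensor_holds hX hY) hX
        (SemiCartesianMonoidalCategory.fst X Y) (rfl : 2 * 1 + 2 * 2 + 2 * 2 = 2 * 1 + 2 * (2 + 2))) ∘ₗ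
      ((cupProduct (rfl : 2 * 1 + 2 * 2 = 2 * 1 + 2 * 2)).flip γ) ∘ₗ
      (complexBetti.map (SemiCartesianMonoidalCategory.snd X Y) (2 * 1)).hom with hφdef
  have hφ : ∀ y, φ y = Corr[complexOrientationFamily, X, Y, hX, hY ; γ, y] := fun y ↦ rfl
  obtain ⟨g, hg⟩ := exists_ratHom_of_isRationalClass φ fun y hy ↦ by rw [hφ]; exact hrat y hy
  obtain ⟨w₀, rfl⟩ := (isRationalClass_iff_mem_range_ofRatClass _).1 hw
  -- the rational functional `a ↦ ∫_X g(a) ∪ w₀` and its representing class `b₀`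
  let ℓ : Module.Dual ℚ (bettiCohomology Y (2 * 1)) :=
    (trace hX) ∘ₗ ((cupProduct (X := Motives.ComplexPoints X) (R := ℚ) h4).flip w₀) ∘ₗ g
  have hℓ : ∀ a, ℓ a = trace hX (cupProduct (X := Motives.ComplexPoints X) (R := ℚ) h4 (g a) w₀) :=
    fun a ↦ rfl
  set b₀ : bettiCohomology Y (2 * 1) :=
    ((cupPairingBetti hY).toDual (OddPrimeSquares.cupPairingBetti_nondegenerate hY)).symm ℓ with hb₀
  have hb₀ℓ : ∀ a, cupPairingBetti hY b₀ a = ℓ a := fun a ↦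
    LinearMap.BilinForm.apply_toDual_symm_apply (hB := OddPrimeSquares.cupPairingBetti_nondegenerate hY) ℓ a
  -- `ᵗφ(w) = b₀`: test against rational classes, which span
  set z := Corr[complexOrientationFamily, Y, X, hY, hX ; Transp[X, Y ; γ],
    ofRatClass (Motives.ComplexPoints X) (2 * 1) w₀] with hzdef
  suffices hz : z = ofRatClass (Motives.ComplexPoints Y) (2 * 1) b₀ by
    rw [hz]
    exact isRationalClass_ofRatClass b₀
  rw [← sub_eq_zero]
  apply eq_zero_of_forall_traceC_cup_eq_zero hY h4
  intro x
  have hx : x ∈ Submodule.span ℂ {c : complexBetti Y (2 * 1) | IsRationalClass c} := by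
    rw [span_isRationalClass_eq_top_of_isSmoothProjective_holds 2 Y hY (2 * 1)]
    exact Submodule.mem_top
  induction hx using Submodule.span_induction with
  | mem x hx =>
    obtain ⟨a, rfl⟩ := (isRationalClass_iff_mem_range_ofRatClass _).1 hx
    rw [map_sub, LinearMap.sub_apply, map_sub, hzdef, traceC_transpose_cup hX hY γ, ← hφ, ← hg,
      sub_eq_zero]
    -- both sides are rational numbers: `∫_X g(a) ∪ w₀ = ∫_Y b₀ ∪ a`
    have hL : traceC hX (cupProduct h4 (ofRatClass (Motives.ComplexPoints X) (2 * 1) (g a))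
        (ofRatClass (Motives.ComplexPoints X) (2 * 1) w₀)) = algebraMap ℚ ℂ (ℓ a) := by
      rw [hℓ, ofRatClass_eq_ringChange, ofRatClass_eq_ringChange, ← singularCohomology.ringChange_cupProduct,
        traceC_ringChange]
    have hR : traceC hY (cupProduct h4 (ofRatClass (Motives.ComplexPoints Y) (2 * 1) b₀)
        (ofRatClass (Motives.ComplexPoints Y) (2 * 1) a)) = algebraMap ℚ ℂ (cupPairingBetti hY b₀ a) := by
      rw [cupPairingBetti_apply, ofRatClass_eq_ringChange, ofRatClass_eq_ringChange,
        ← singularCohomology.ringChange_cupProduct, traceC_ringChange]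
    rw [hL, hR, hb₀ℓ a]
  | zero => rw [map_zero, map_zero]
  | add x x' _ _ hx hx' => rw [map_add, map_add, hx, hx', add_zero]
  | smul t x _ hx => rw [map_smul, map_smul, hx, smul_zero]

/-! ### The transpose maps `T(X)` into `T(Y)` -/

/-- **`ᵗφ(T(X)) ⊆ T(Y)` when `φ` is rational and `(1,1)`-type preserving** (then `φ(N¹(Y)) ⊆ N¹(X)`
by Lefschetz `(1,1)`, `SectorTransport.map_mem_algebraicClasses_one`; for `w ∈ T(X)` and `n ∈ N¹(Y)`,
`∫_Y ᵗφ(w) ∪ n = ∫_X φ(n) ∪ w = 0`, and `H⁴(Y) ≅ ℂ` by `∫_Y`). [cite: Kahn2020, §3.5.3 Lemma 3.48]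
[cite: VoisinHodgeI2002, Thm. 11.30] -/
theorem transpose_mem_transcendentalSubspace (hX : IsSmoothProjective 2 X) (hY : IsSmoothProjective 2 Y)
    (γ : complexBetti (X ⊗ Y) (2 * 2))
    (hrat : ∀ y, IsRationalClass y → IsRationalClass (Corr[complexOrientationFamily, X, Y, hX, hY ; γ, y]))
    (htyp : ∀ y, IsOfHodgeType 2 Y (2 * 1) 1 1 y →
      IsOfHodgeType 2 X (2 * 1) 1 1 (Corr[complexOrientationFamily, X, Y, hX, hY ; γ, y]))
    {w : complexBetti X (2 * 1)} (hw : w ∈ transcendentalSubspace X) :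
    Corr[complexOrientationFamily, Y, X, hY, hX ; Transp[X, Y ; γ], w] ∈ transcendentalSubspace Y := by
  have h4 : 2 * 1 + 2 * 1 = 2 * 2 := rfl
  set φ : complexBetti Y (2 * 1) →ₗ[ℂ] complexBetti X (2 * 1) :=
    (complexGysin complexOrientationFamily (IsSmoothProjective.tensor_holds hX hY) hX
        (SemiCartesianMonoidalCategory.fst X Y) (rfl : 2 * 1 + 2 * 2 + 2 * 2 = 2 * 1 + 2 * (2 + 2))) ∘ₗ
      ((cupProduct (rfl : 2 * 1 + 2 * 2 = 2 * 1 + 2 * 2)).flip γ) ∘ₗ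
      (complexBetti.map (SemiCartesianMonoidalCategory.snd X Y) (2 * 1)).hom with hφdef
  have hφ : ∀ y, φ y = Corr[complexOrientationFamily, X, Y, hX, hY ; γ, y] := fun y ↦ rfl
  have hφN : ∀ n ∈ algebraicClasses Y 1, φ n ∈ algebraicClasses X 1 := fun n hn ↦
    SectorTransport.map_mem_algebraicClasses_one hX hY φ (fun y hy ↦ by rw [hφ]; exact hrat y hy)
      (fun y hy ↦ by rw [hφ]; exact htyp y hy) hn
  rw [mem_transcendentalSubspace_iff_forall_algebraicClasses hY]
  intro n hn
  apply eq_zero_of_traceC_eq_zero hY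
  rw [traceC_transpose_cup hX hY γ, ← hφ]
  rw [mem_transcendentalSubspace_iff_forall_algebraicClasses hX] at hw
  have h0 : cupProduct h4 w (φ n) = 0 := hw _ (hφN n hn)
  rw [cupProduct_gradedComm_holds ℂ _ h4 h4, h0, smul_zero, map_zero]

/-! ### A similitude: `ᵗφ ∘ φ = c • id` on `T(Y)` and `φ ∘ ᵗφ = c • id` on `T(X)` -/

/-- **`ᵗφ(φ(y)) = c · y` on `T(Y)`, `c = m · ∫_X p_X / ∫_Y p_Y`**, for `φ = [γ]_*` rational and
`(1,1)`-type preserving, mapping `T(Y)` into `T(X)` with MULTIPLIER `m` in markings `(η_X, p_X)`,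
`(η_Y, p_Y)` (`a ∪ b = (η a · η b) • p` on each surface; `(η_X φa · η_X φb) = m (η_Y a · η_Y b)` on
`T(Y)`). Proof: test `ᵗφφy − cy` against `x = n + t ∈ N¹(Y) + T(Y)` under `∫_Y (·) ∪ x` (Poincaré
duality): `∫_Y ᵗφ(φy) ∪ x = ∫_X φ(x) ∪ φ(y)`; for `t` both sides are `m (η_Y y · η_Y t) ∫_X p_X`, for `n`
both vanish (`φ n ∈ N¹(X) ⊥ φ y ∈ T(X)`, `n ⊥ y`). [cite: Varesco2023, §2 (φ = β_*π^*, multiplier p)]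
[cite: Kahn2020, §3.5.3 Lemma 3.48] -/
theorem transpose_comp_eq_smul (hX : IsSmoothProjective 2 X) (hY : IsSmoothProjective 2 Y)
    (ηX : complexBetti X (2 * 1) ≃ₗ[ℂ] (K3Index → ℂ)) (pX : complexBetti X (2 * 2))
    (ηY : complexBetti Y (2 * 1) ≃ₗ[ℂ] (K3Index → ℂ)) (pY : complexBetti Y (2 * 2)) (hpY : pY ≠ 0)
    (hηX : ∀ a b : complexBetti X (2 * 1),
      cupProduct (rfl : 2 * 1 + 2 * 1 = 2 * 2) a b = k3Form (ηX a) (ηX b) • pX)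
    (hηY : ∀ a b : complexBetti Y (2 * 1),
      cupProduct (rfl : 2 * 1 + 2 * 1 = 2 * 2) a b = k3Form (ηY a) (ηY b) • pY)
    (γ : complexBetti (X ⊗ Y) (2 * 2))
    (hrat : ∀ y, IsRationalClass y → IsRationalClass (Corr[complexOrientationFamily, X, Y, hX, hY ; γ, y]))
    (htyp : ∀ y, IsOfHodgeType 2 Y (2 * 1) 1 1 y →
      IsOfHodgeType 2 X (2 * 1) 1 1 (Corr[complexOrientationFamily, X, Y, hX, hY ; γ, y]))
    (hT : ∀ y ∈ transcendentalSubspace Y,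
      Corr[complexOrientationFamily, X, Y, hX, hY ; γ, y] ∈ transcendentalSubspace X)
    {m : ℂ} (hmul : ∀ a ∈ transcendentalSubspace Y, ∀ b ∈ transcendentalSubspace Y,
      k3Form (ηX (Corr[complexOrientationFamily, X, Y, hX, hY ; γ, a]))
        (ηX (Corr[complexOrientationFamily, X, Y, hX, hY ; γ, b])) = m * k3Form (ηY a) (ηY b))
    {y : complexBetti Y (2 * 1)} (hy : y ∈ transcendentalSubspace Y) :
    Corr[complexOrientationFamily, Y, X, hY, hX ; Transp[X, Y ; γ],
        Corr[complexOrientationFamily, X, Y, hX, hY ; γ, y]] =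
      (m * traceC hX pX * (traceC hY pY)⁻¹) • y := by
  have h4 : 2 * 1 + 2 * 1 = 2 * 2 := rfl
  set φ : complexBetti Y (2 * 1) →ₗ[ℂ] complexBetti X (2 * 1) :=
    (complexGysin complexOrientationFamily (IsSmoothProjective.tensor_holds hX hY) hX
        (SemiCartesianMonoidalCategory.fst X Y) (rfl : 2 * 1 + 2 * 2 + 2 * 2 = 2 * 1 + 2 * (2 + 2))) ∘ₗ
      ((cupProduct (rfl : 2 * 1 + 2 * 2 = 2 * 1 + 2 * 2)).flip γ) ∘ₗ
      (complexBetti.map (SemiCartesianMonoidalCategory.snd X Y) (2 * 1)).hom with hφdef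
  have hφ : ∀ y, φ y = Corr[complexOrientationFamily, X, Y, hX, hY ; γ, y] := fun y ↦ rfl
  have hφN : ∀ n ∈ algebraicClasses Y 1, φ n ∈ algebraicClasses X 1 := fun n hn ↦
    SectorTransport.map_mem_algebraicClasses_one hX hY φ (fun y hy ↦ by rw [hφ]; exact hrat y hy)
      (fun y hy ↦ by rw [hφ]; exact htyp y hy) hn
  have hτY : traceC hY pY ≠ 0 := fun h ↦ hpY (eq_zero_of_traceC_eq_zero hY h)
  set c : ℂ := m * traceC hX pX * (traceC hY pY)⁻¹ with hcdef
  rw [← hφ y, ← sub_eq_zero]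
  apply eq_zero_of_forall_traceC_cup_eq_zero hY h4
  intro x
  obtain ⟨n, hn, ht⟩ := exists_algebraic_add_transcendental hY x
  set t := x - n with htdef
  have hx : x = n + t := by rw [htdef]; abel
  have hyT := (mem_transcendentalSubspace_iff_forall_algebraicClasses hY y).1 hy
  have hφyT := (mem_transcendentalSubspace_iff_forall_algebraicClasses hX _).1 (hT y hy)
  -- the pairing with `n` vanishes on both sides
  have hn1 : traceC hY (cupProduct h4 (Corr[complexOrientationFamily, Y, X, hY, hX ; Transp[X, Y ; γ], φ y]) n) = 0 := by
    rw [traceC_transpose_cup hX hY γ, ← hφ]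
    have h0 : cupProduct h4 (φ y) (φ n) = 0 := hφyT _ (hφN n hn)
    rw [cupProduct_gradedComm_holds ℂ _ h4 h4, h0, smul_zero, map_zero]
  have hn2 : traceC hY (cupProduct h4 (c • y) n) = 0 := by
    rw [map_smul, LinearMap.smul_apply, hyT n hn, smul_zero, map_zero]
  -- the pairing with `t ∈ T(Y)`
  have ht1 : traceC hY (cupProduct h4 (Corr[complexOrientationFamily, Y, X, hY, hX ; Transp[X, Y ; γ], φ y]) t) =
      m * k3Form (ηY t) (ηY y) * traceC hX pX := by
    rw [traceC_transpose_cup hX hY γ, ← hφ, hηX, map_smul, smul_eq_mul, hφ, hφ, hmul t ht y hy]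
  have ht2 : traceC hY (cupProduct h4 (c • y) t) = m * k3Form (ηY t) (ηY y) * traceC hX pX := by
    rw [map_smul, LinearMap.smul_apply, hηY, map_smul, map_smul, smul_eq_mul, smul_eq_mul, hcdef,
      k3Form_comm (ηY y) (ηY t)]
    field_simp
  rw [hx, map_add, map_add, map_sub, LinearMap.sub_apply, LinearMap.sub_apply, map_sub, map_sub,
    hn1, hn2, ht1, ht2, sub_self, sub_self, add_zero]

/-- **`φ(ᵗφ(z)) = c · z` on `T(X)`** (same `c`), when moreover `φ` maps `T(Y)` ONTO `T(X)`: write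
`z = φ y` and apply `transpose_comp_eq_smul`. [cite: Varesco2023, §2] [cite: Kahn2020, §3.5.3 Lemma 3.48] -/
theorem comp_transpose_eq_smul (hX : IsSmoothProjective 2 X) (hY : IsSmoothProjective 2 Y)
    (ηX : complexBetti X (2 * 1) ≃ₗ[ℂ] (K3Index → ℂ)) (pX : complexBetti X (2 * 2))
    (ηY : complexBetti Y (2 * 1) ≃ₗ[ℂ] (K3Index → ℂ)) (pY : complexBetti Y (2 * 2)) (hpY : pY ≠ 0)
    (hηX : ∀ a b : complexBetti X (2 * 1),
      cupProduct (rfl : 2 * 1 + 2 * 1 = 2 * 2) a b = k3Form (ηX a) (ηX b) • pX)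
    (hηY : ∀ a b : complexBetti Y (2 * 1),
      cupProduct (rfl : 2 * 1 + 2 * 1 = 2 * 2) a b = k3Form (ηY a) (ηY b) • pY)
    (γ : complexBetti (X ⊗ Y) (2 * 2))
    (hrat : ∀ y, IsRationalClass y → IsRationalClass (Corr[complexOrientationFamily, X, Y, hX, hY ; γ, y]))
    (htyp : ∀ y, IsOfHodgeType 2 Y (2 * 1) 1 1 y →
      IsOfHodgeType 2 X (2 * 1) 1 1 (Corr[complexOrientationFamily, X, Y, hX, hY ; γ, y]))
    (hT : ∀ y ∈ transcendentalSubspace Y,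
      Corr[complexOrientationFamily, X, Y, hX, hY ; γ, y] ∈ transcendentalSubspace X)
    (honto : ∀ z ∈ transcendentalSubspace X, ∃ y ∈ transcendentalSubspace Y,
      Corr[complexOrientationFamily, X, Y, hX, hY ; γ, y] = z)
    {m : ℂ} (hmul : ∀ a ∈ transcendentalSubspace Y, ∀ b ∈ transcendentalSubspace Y,
      k3Form (ηX (Corr[complexOrientationFamily, X, Y, hX, hY ; γ, a]))
        (ηX (Corr[complexOrientationFamily, X, Y, hX, hY ; γ, b])) = m * k3Form (ηY a) (ηY b))
    {z : complexBetti X (2 * 1)} (hz : z ∈ transcendentalSubspace X) :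
    Corr[complexOrientationFamily, X, Y, hX, hY ; γ,
        Corr[complexOrientationFamily, Y, X, hY, hX ; Transp[X, Y ; γ], z]] =
      (m * traceC hX pX * (traceC hY pY)⁻¹) • z := by
  obtain ⟨y, hy, rfl⟩ := honto z hz
  rw [transpose_comp_eq_smul hX hY ηX pX ηY pY hpY hηX hηY γ hrat htyp hT hmul hy, map_smul, map_smul,
    LinearMap.smul_apply, map_smul]

end Summit.HodgeConjecture.HodgeConjecture.Theorems.MarkmanPartnerTransport.SimilitudeTranspose

end
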